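import Mathlib
import Literature.AlgebraicGeometry.Resolution.CobordantGame
import Literature.AlgebraicGeometry.Resolution.CobordantChartCoefficients
import Literature.AlgebraicGeometry.Resolution.CobordantChartPlaneSlice
import Literature.AlgebraicGeometry.Resolution.PowerSeriesRegularLocal
import Literature.AlgebraicGeometry.Resolution.PointBlowupPolygonLaws
import Literature.AlgebraicGeometry.Resolution.FormalCoordinateChange
import Summits.ResolutionOfSingularities.ResolutionOfSingularities.Theorems.WeightedInvariantLocalWeightedDropPointChartTransport

/-!
# `LocalWeightedDrop`: a CJS polygon law on a game move — `β` does not increase at a near point of the `u₁`-chart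

Route `ResolutionOfSingularities/WeightedInvariant`, crux `LocalWeightedDrop` (stmt-ResolutionOfSingularities-8899), line
`hasse-ridge-face-selection` (chain w43, [OURS · L1 W4.3]).  END-TO-END INSTANCE of the bridge (a): the landed Literature law
`PointBlowupPolygonLaws.betaS_colon_le` (CJS Lemma 12.1 (3): `β(J′) = γ⁻(J) ≤ β(J)`) applied to the game's point blow-up of a
surface germ `f ∈ k[[X₀, X₁, X₂]]` at an exceptional point `c` with `c₁ ≠ 0`, sliced at the slot `1`: with the translated
parameters `c̃` and the chart parameters `c′` of `…PointChartTransport`, the weak transform is the ideal of the slice `Sl`, so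
`β(c′; (Sl); d) ≤ β(c̃; (f); d)` whenever `(f) ⊆ 𝔪^d`, the polygon of `f` w.r.t. `c̃` is non-empty and `δ > 1`
(`betaS_slice_le`).  The glue: `colon_span_singleton_mul` (`((u·g)) : u = (g)` in a domain), `weakTransform_eq_span_slice`.
This is the pattern by which the surface pieces S2/S3 consume the CJS laws; nothing about δ-preparedness is claimed here.
-/

set_option linter.dupNamespace false -- mandated namespace of this single-conjunct summit

namespace Summit.ResolutionOfSingularities.ResolutionOfSingularities.Theorems

open Literature.AlgebraicGeometry.Resolution

namespace PointChartTransport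

variable {k : Type} [Field k]

/-- In a domain, `((u · g) : u) = (g)` for `u ≠ 0`. -/
theorem colon_span_singleton_mul {A : Type*} [CommRing A] [NoZeroDivisors A] {u : A} (hu : u ≠ 0) (g : A) :
    Submodule.colon (Ideal.span {u * g}) ({u} : Set A) = Ideal.span {g} := by
  ext x
  rw [Submodule.mem_colon_singleton, smul_eq_mul, Ideal.mem_span_singleton', Ideal.mem_span_singleton']
  constructor
  · rintro ⟨r, hr⟩
    refine ⟨r, mul_left_cancel₀ hu ?_⟩
    linear_combination hr
  · rintro ⟨r, rfl⟩
    exact ⟨r, by ring⟩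

/-- THE WEAK TRANSFORM OF THE GAME'S POINT BLOW-UP IS THE IDEAL OF THE SLICE: with `φ` the substitution along the restricted
chart and `u₁ = c̃₁ = X₁`, `((f) R′ : (φ u₁)^d) = (Sl)`. -/
theorem weakTransform_eq_span_slice (c : Fin 3 → k) (hc1 : c 1 ≠ 0) (f : MvPowerSeries (Fin 3) k) (d : ℕ)
    (G : MvPowerSeries (Fin 4) k)
    (hfac : MvPowerSeries.subst (CobordantChart.chart (fun _ : Fin 3 => 1) c) f = MvPowerSeries.X 0 ^ d * G) :
    Submodule.colon (Ideal.map (MvPowerSeries.substAlgHom (R := k) (hasSubst_rho c)).toRingHom (Ideal.span {f}))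
        ({(MvPowerSeries.substAlgHom (R := k) (hasSubst_rho c)).toRingHom (MvPowerSeries.X 1 : MvPowerSeries (Fin 3) k) ^ d} :
          Set (MvPowerSeries (Fin 3) k)) =
      Ideal.span {MvPowerSeries.subst (fun j : Fin 4 => if j = (1 : Fin 3).succ then
        (0 : MvPowerSeries (Fin 3) k) else MvPowerSeries.X (Fin.predAbove (1 : Fin 3) j)) G} := by
  have hφ : ∀ x, (MvPowerSeries.substAlgHom (R := k) (hasSubst_rho c)).toRingHom x =
      MvPowerSeries.subst (fun l : Fin 3 => MvPowerSeries.X (0 : Fin 3) ^ ((fun _ : Fin 3 => 1) l) *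
        (MvPowerSeries.C (c l) + if l = (1 : Fin 3) then (0 : MvPowerSeries (Fin 3) k)
          else MvPowerSeries.X (Fin.predAbove (1 : Fin 3) l.succ))) x := fun x => by
    rw [AlgHom.toRingHom_eq_coe, RingHom.coe_coe, MvPowerSeries.coe_substAlgHom]
  rw [Ideal.map_span, Set.image_singleton, hφ, hφ, subst_rho_eq c hc1 f d G hfac, subst_ct_one,
    colon_span_singleton_mul, Ideal.span_singleton_mul_left_unit]
  · exact (MvPowerSeries.isUnit_iff_constantCoeff.mpr (by
      rw [MvPowerSeries.constantCoeff_C]; exact isUnit_iff_ne_zero.mpr (pow_ne_zero _ (inv_ne_zero hc1))))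
  · exact pow_ne_zero _ (mul_ne_zero (fun h => hc1 (MvPowerSeries.C_injective (h.trans (map_zero _).symm)))
      (FormalCoordChange.X_ne_zero' _))

/-- **`β` DOES NOT INCREASE AT A NEAR POINT OF THE `u₁`-CHART OF A GAME MOVE** (CJS Lemma 12.1 (3) / Cossart–Piltant 4.5 (2),
Literature `PointBlowupPolygonLaws.betaS_colon_le`, instantiated): for the point blow-up of `f ∈ k[[X₀,X₁,X₂]]` at `c`,
`c₁ ≠ 0`, with `f(chart) = s^d · G` and slice `Sl = G|_{y₁ = 0}`: if `(f) ⊆ 𝔪^d`, the scaled polygon of `(f)` w.r.t. the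
translated parameters `c̃` is non-empty and `δ(f; c̃) > 1` (scaled: `d! < δS`), then `βS(c′; (Sl); d) ≤ βS(c̃; (f); d)`. -/
theorem betaS_slice_le (c : Fin 3 → k) (hc1 : c 1 ≠ 0) (f : MvPowerSeries (Fin 3) k) (d : ℕ)
    (G : MvPowerSeries (Fin 4) k)
    (hfac : MvPowerSeries.subst (CobordantChart.chart (fun _ : Fin 3 => 1) c) f = MvPowerSeries.X 0 ^ d * G)
    (hJμ : Ideal.span {f} ≤ IsLocalRing.maximalIdeal (MvPowerSeries (Fin 3) k) ^ d)
    (hne : (pts (![MvPowerSeries.X 0 - MvPowerSeries.C (c 0 / c 1) * MvPowerSeries.X 1, MvPowerSeries.X 1,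
      MvPowerSeries.X 2 - MvPowerSeries.C (c 2 / c 1) * MvPowerSeries.X 1] : Fin 3 → MvPowerSeries (Fin 3) k)
      (Ideal.span {f}) d).Nonempty)
    (hδ : d.factorial < deltaS (![MvPowerSeries.X 0 - MvPowerSeries.C (c 0 / c 1) * MvPowerSeries.X 1, MvPowerSeries.X 1,
      MvPowerSeries.X 2 - MvPowerSeries.C (c 2 / c 1) * MvPowerSeries.X 1] : Fin 3 → MvPowerSeries (Fin 3) k)
      (Ideal.span {f}) d) :
    betaS (![MvPowerSeries.C (c 1)⁻¹ * MvPowerSeries.X 1, MvPowerSeries.C (c 1) * MvPowerSeries.X 0,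
        MvPowerSeries.C (c 1)⁻¹ * MvPowerSeries.X 2] : Fin 3 → MvPowerSeries (Fin 3) k)
      (Ideal.span {MvPowerSeries.subst (fun j : Fin 4 => if j = (1 : Fin 3).succ then
        (0 : MvPowerSeries (Fin 3) k) else MvPowerSeries.X (Fin.predAbove (1 : Fin 3) j)) G}) d ≤
    betaS (![MvPowerSeries.X 0 - MvPowerSeries.C (c 0 / c 1) * MvPowerSeries.X 1, MvPowerSeries.X 1,
        MvPowerSeries.X 2 - MvPowerSeries.C (c 2 / c 1) * MvPowerSeries.X 1] : Fin 3 → MvPowerSeries (Fin 3) k)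
      (Ideal.span {f}) d := by
  haveI : IsRegularLocalRing (MvPowerSeries (Fin 3) k) := isRegularLocalRing_mvPowerSeries k (Fin 3)
  have hdim : ringKrullDim (MvPowerSeries (Fin 3) k) = 3 := by
    rw [ringKrullDim_mvPowerSeries, Nat.card_eq_fintype_card, Fintype.card_fin]
    rfl
  set φ : MvPowerSeries (Fin 3) k →+* MvPowerSeries (Fin 3) k :=
    (MvPowerSeries.substAlgHom (R := k) (hasSubst_rho c)).toRingHom with hφdef
  have hφ : ∀ x, φ x = MvPowerSeries.subst (fun l : Fin 3 => MvPowerSeries.X (0 : Fin 3) ^ ((fun _ : Fin 3 => 1) l) *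
      (MvPowerSeries.C (c l) + if l = (1 : Fin 3) then (0 : MvPowerSeries (Fin 3) k)
        else MvPowerSeries.X (Fin.predAbove (1 : Fin 3) l.succ))) x := fun x => by
    rw [hφdef, AlgHom.toRingHom_eq_coe, RingHom.coe_coe, MvPowerSeries.coe_substAlgHom]
  set ct : Fin 3 → MvPowerSeries (Fin 3) k := ![MvPowerSeries.X 0 - MvPowerSeries.C (c 0 / c 1) * MvPowerSeries.X 1,
    MvPowerSeries.X 1, MvPowerSeries.X 2 - MvPowerSeries.C (c 2 / c 1) * MvPowerSeries.X 1] with hct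
  set cp : Fin 3 → MvPowerSeries (Fin 3) k := ![MvPowerSeries.C (c 1)⁻¹ * MvPowerSeries.X 1,
    MvPowerSeries.C (c 1) * MvPowerSeries.X 0, MvPowerSeries.C (c 1)⁻¹ * MvPowerSeries.X 2] with hcp
  have hct0 : ct 0 = MvPowerSeries.X 0 - MvPowerSeries.C (c 0 / c 1) * MvPowerSeries.X 1 := rfl
  have hct1 : ct 1 = MvPowerSeries.X 1 := rfl
  have hct2 : ct 2 = MvPowerSeries.X 2 - MvPowerSeries.C (c 2 / c 1) * MvPowerSeries.X 1 := rfl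
  have hcp0 : cp 0 = MvPowerSeries.C (c 1)⁻¹ * MvPowerSeries.X 1 := rfl
  have hcp1 : cp 1 = MvPowerSeries.C (c 1) * MvPowerSeries.X 0 := rfl
  have hcp2 : cp 2 = MvPowerSeries.C (c 1)⁻¹ * MvPowerSeries.X 2 := rfl
  have h₁ : cp 1 = φ (ct 1) := by
    rw [hφ, hct1, hcp1, subst_ct_one]
  have h₀ : φ (ct 0) = φ (ct 1) * cp 0 := by
    rw [hφ, hφ, hct0, hct1, hcp0, subst_ct_zero c hc1, subst_ct_one]
  have h₂ : φ (ct 2) = φ (ct 1) * cp 2 := by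
    rw [hφ, hφ, hct2, hct1, hcp2, subst_ct_two c hc1, subst_ct_one]
  have hgen : Ideal.span {ct 0, ct 1, ct 2} = IsLocalRing.maximalIdeal _ := span_ct_eq_maximalIdeal c
  have hgen' : Ideal.span {cp 0, cp 1, cp 2} = IsLocalRing.maximalIdeal _ := span_cprime_eq_maximalIdeal c hc1
  have key := betaS_colon_le φ h₁ h₀ h₂ hgen hdim hgen' hdim hJμ hne hδ
  have hJ' : Submodule.colon (Ideal.map φ (Ideal.span {f})) ({φ (ct 1) ^ d} : Set (MvPowerSeries (Fin 3) k)) =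
      Ideal.span {MvPowerSeries.subst (fun j : Fin 4 => if j = (1 : Fin 3).succ then
        (0 : MvPowerSeries (Fin 3) k) else MvPowerSeries.X (Fin.predAbove (1 : Fin 3) j)) G} := by
    rw [hφdef]
    exact weakTransform_eq_span_slice c hc1 f d G hfac
  rw [hJ'] at key
  exact key

end PointChartTransport

end Summit.ResolutionOfSingularities.ResolutionOfSingularities.Theorems
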